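import Summits.ResolutionOfSingularities.ResolutionOfSingularities.Theorems.FrobeniusClosingSteerBinaryResidueOddSatellite
import HarnessLib

/-!
# hARᵒ H2 — F4a: **the CONE at an A-stage in front of an EVEN SATELLITE** (case (β) of the H2ₘ decomposition, first half;
# characteristic `2`; Theses-free, def-free)

OURS (campaign `res-hironaka`, rung L ★L-G4, slot W4.1 · crux `Steer` (stmt-ResolutionOfSingularities-16345) · hARᵒ slot H2; P0 brief
`L/res-L0-w41-plan-1/P0-BRIEF-hARo.md` b66a17a38113b83f; design res-type-062 g15 `H2-DESIGN.md` 7dac75913b6b98e3 §5 (β) «parity + F1 (m = n = 3)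
cone at A′ for the window (A′, N) adapted with v₀ = x ⇒ F̃′_{A′} ∈ (x) + (w₂,w₃)^d + 𝔪^(d+1)»; seat res-D-repro-2 g9, P0 main hand). Over F1
`BinaryResidue.mem_sup_of_window` (p545669), the parity lemma `exists_sub_mul_sq_mem_pow_of_mul_sub_sq_mem_pow` (p546632) and F3's §1 helpers
(p547879). Not a statement of the manuscript under review [claim: Hironaka2017, status: under-review]; AI-produced, weaker than expert review.

THE SETTING. A rational point window `S ≤ S' ⊆ L` (the A-stage `A′` and the visit `N′` after it): `𝔪_S = (x₂, w₀, w₁, w₂)`, `w_j = x₂·w'_j`,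
`𝔪_{S'} = (x₂, w')` (`S'` regular of dimension `4`; in the application `w₀ = x` is the tracked old parameter — the SATELLITE choice
`exists_adapted_window_cons`, but this file does not use it); `F ∈ 𝔪_S^d` (the unit multiple of the cleaned radicand at `A′`, `d + 1 = 2e`) with weak
transform `F'` (`F'·x₂^d = F`).

* §1 `sup_pow_le_sup_pow` — `(A ⊔ B)^n ≤ A ⊔ B^n` for ideals.
* §2 `mem_sup_of_mul_sub_sq_mem_pow` — CORE: if `x₂·F' − g'² ∈ 𝔪_{S'}^(d+1)` for some `g'` (the member at `N′` has cleaned order `≥ d + 1` and is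
  `x₂·F'` up to a unit and squares), then `F ∈ (w₀) + (w₁, w₂)^d + 𝔪_S^(d+1)`: parity ⇒ `F' − x₂q² ∈ 𝔪_{S'}^d ⊆ (w')^d + (x₂)` ⇒ F1 with ALL THREE
  adapted parameters ⇒ `F ∈ (ℓ₀, ℓ₁, ℓ₂)^d + 𝔪_S^(d+1)` with `ℓ_k ≡ w_k (mod 𝔪_S²)` (the coefficient matrix is `≡ 1` modulo `𝔪_{S'}`, read off the
  regular system `(x₂, w')` of `S'`, and units descend) ⇒ `(ℓ)^d ⊆ (w)^d + 𝔪_S^(d+1)` (`pow_le_pow_sup_pow_succ`) ⇒ `(w)^d ⊆ (w₀) + (w₁, w₂)^d`.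
* §2 `mem_sup_of_law_of_clean` — the same with the hypothesis produced from the squared visit law at `(A′, N′)`
  (`f₃·x₂^(d−1)·W'² = F + E²`) and a cleaner of order `d + 1` at `N′` (`x₂^(e−1) ∣ E`, then `W'²f₃ = x₂F' + Δ²`).
[cite: Matsumura1987, Thm. 14.2, Thm. 17.10] [folklore]
-/

noncomputable section

-- `Summit.<S>.<S>.…` duplicates the summit name by design (single-problem summit).
set_option linter.dupNamespace false

open IsLocalRing MvPolynomial

namespace Summit.ResolutionOfSingularities.ResolutionOfSingularities.Theorems.SwitchingDichotomy.BinaryResidue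

open Literature.AlgebraicGeometry.Resolution

/-! ## §1 An ideal inequality -/

/-- `(A ⊔ B)^n ≤ A ⊔ B^n`: every product of `n` elements of `A + B` lies in `A` unless all factors are taken from `B`. [folklore] -/
theorem sup_pow_le_sup_pow {R : Type*} [CommRing R] (A B : Ideal R) (n : ℕ) : (A ⊔ B) ^ n ≤ A ⊔ B ^ n := by
  induction n with
  | zero => simp
  | succ n ih =>
    calc (A ⊔ B) ^ (n + 1) = (A ⊔ B) * (A ⊔ B) ^ n := pow_succ' _ n
      _ ≤ (A ⊔ B) * (A ⊔ B ^ n) := Ideal.mul_mono_right ih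
      _ ≤ A ⊔ B ^ (n + 1) := by
        rw [Ideal.sup_mul, Ideal.mul_sup, Ideal.mul_sup]
        refine sup_le (sup_le ?_ ?_) (sup_le ?_ ?_)
        · exact le_sup_of_le_left Ideal.mul_le_right
        · exact le_sup_of_le_left Ideal.mul_le_right
        · exact le_sup_of_le_left Ideal.mul_le_left
        · rw [← pow_succ']
          exact le_sup_right

variable {L : Type} [Field L]

/-! ## §2 The cone at `A′` -/

/-- **CORE (the cone in front of an even satellite).** See the module docstring. [cite: Matsumura1987, Thm. 14.2, Thm. 17.10] [folklore] -/
theorem mem_sup_of_mul_sub_sq_mem_pow (h2 : (2 : L) = 0) (S S' : Subring L) [IsLocalRing S] [IsLocalRing S']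
    (hle : S ≤ S') (hreg' : IsRegularLocalRing S') (hdim' : ringKrullDim S' = (4 : ℕ))
    (x₂ : S) (hx₂0 : (x₂ : L) ≠ 0) (w : Fin 3 → S) (hx₂w : Ideal.span (insert x₂ (Set.range w)) = maximalIdeal S)
    (w' : Fin 3 → S') (hw : ∀ j, ((w j : S) : L) = (x₂ : L) * ((w' j : S') : L))
    (hm' : Ideal.span (insert (⟨(x₂ : L), hle x₂.2⟩ : S') (Set.range w')) = maximalIdeal S')
    (hrat : ∀ a : S', ∃ b : S, a - ⟨(b : L), hle b.2⟩ ∈ maximalIdeal S')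
    {d e : ℕ} (hde : d + 1 = 2 * e) (F : S) (hFd : F ∈ maximalIdeal S ^ d) (F' : S')
    (hlaw : ((F' : S') : L) * (x₂ : L) ^ d = ((F : S) : L))
    (hyp : ∃ g' : S', (⟨(x₂ : L), hle x₂.2⟩ : S') * F' - g' ^ 2 ∈ maximalIdeal S' ^ (d + 1)) :
    F ∈ Ideal.span {w 0} ⊔ Ideal.span (Set.range fun j : Fin 2 => w j.succ) ^ d ⊔ maximalIdeal S ^ (d + 1) := by
  classical
  haveI := hreg'
  haveI := isDomain_of_isRegularLocalRing S'
  have he : 1 ≤ e := by omega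
  have h2S' : (2 : S') = 0 := Subtype.ext (by change S'.subtype 2 = S'.subtype 0; rw [map_ofNat, map_zero]; exact h2)
  set x' : S' := ⟨(x₂ : L), hle x₂.2⟩ with hx'
  -- the regular system `(x₂, w')` of `S'`
  have hsfr : (maximalIdeal S').spanFinrank = 4 := by
    have h := IsRegularLocalRing.spanFinrank_maximalIdeal (R := S')
    rw [hdim'] at h
    exact_mod_cast h
  set z : Fin 4 → S' := Fin.cons x' w' with hz
  have hzspan : Ideal.span (Set.range z) = maximalIdeal S' := by rw [hz, Fin.range_cons, hm']
  have hx'm : x' ∈ maximalIdeal S' := by rw [← hm']; exact Ideal.subset_span (Set.mem_insert _ _)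
  have hx'2 : x' ∉ maximalIdeal S' ^ 2 := by
    have := not_mem_sq_of_span_eq hsfr z hzspan 0
    simpa [hz] using this
  have hw'm : ∀ j, w' j ∈ maximalIdeal S' := fun j => hm' ▸ Ideal.subset_span (Set.mem_insert_of_mem _ ⟨j, rfl⟩)
  have hwm : ∀ j, w j ∈ maximalIdeal S := fun j => hx₂w ▸ Ideal.subset_span (Set.mem_insert_of_mem _ ⟨j, rfl⟩)
  -- PARITY at `S'`: `F' − x₂ q² ∈ 𝔪'^d`
  obtain ⟨g', hg'⟩ := hyp
  rw [hde] at hg'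
  obtain ⟨q, hq⟩ := exists_sub_mul_sq_mem_pow_of_mul_sub_sq_mem_pow h2S' hx'm hx'2 he hg'
  rw [show 2 * e - 1 = d by omega] at hq
  -- the input of F1 with all three adapted parameters: `F' ∈ (w')^d + 𝔪'^(d+1) + (x₂)`
  have hinput : F' ∈ Ideal.span (Set.range w') ^ d ⊔ maximalIdeal S' ^ (d + 1) ⊔ Ideal.span {x'} := by
    have e1 : F' = (F' - x' * q ^ 2) + x' * q ^ 2 := by ring
    rw [e1]
    refine add_mem ?_ (Ideal.mem_sup_right (Ideal.mul_mem_right _ _ (Ideal.mem_span_singleton_self _)))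
    have hmd : maximalIdeal S' ^ d ≤ Ideal.span {x'} ⊔ Ideal.span (Set.range w') ^ d := by
      rw [← hm', Ideal.span_insert]
      exact sup_pow_le_sup_pow _ _ d
    have h' := hmd hq
    obtain ⟨a, ha, b, hb, hab⟩ := Submodule.mem_sup.mp h'
    rw [← hab]
    exact add_mem (Ideal.mem_sup_right ha) (Ideal.mem_sup_left (Ideal.mem_sup_left hb))
  -- F1 with `m = n = 3`
  have hdim'' : ringKrullDim S' = ((3 : ℕ) + 1 : ℕ) := by rw [hdim']
  obtain ⟨a, hlin, hmem⟩ := mem_sup_of_window S S' hle hreg' hdim'' x₂ hx₂0 w hx₂w w' hw hm' hrat F F' hlaw hFd w' hw'm hinput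
  -- the coefficient matrix is `≡ 1 (mod 𝔪_S)`
  have hcoef : ∀ k j, (if k = j then (1 : S) else 0) - a k j ∈ maximalIdeal S := by
    intro k j
    -- in `S'`: `Σ_j (δ_kj − a_kj) w'_j ∈ 𝔪'² + (x₂)`
    obtain ⟨m, hm, y, hy, hmy⟩ := Submodule.mem_sup.mp (hlin k)
    obtain ⟨r, hr⟩ := Ideal.mem_span_singleton'.mp hy
    set δ : Fin 3 → S' := fun j => (⟨(((if k = j then (1 : S) else 0) - a k j : S) : L), hle ((if k = j then (1 : S) else 0) - a k j).2⟩ : S')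
      with hδ
    set cvec : Fin 4 → S' := Fin.cons (-r) δ with hcvec
    have hc : ∀ j, δ j = (if k = j then (1 : S') else 0) - ⟨((a k j : S) : L), hle (a k j).2⟩ := by
      intro j; apply Subtype.ext; simp only [hδ]; split_ifs <;> simp
    have hδw : ∑ j, (if k = j then (1 : S') else 0) * w' j = w' k := by simp [Finset.sum_ite_eq]
    have hδsum : ∑ j, δ j * w' j = w' k - ∑ j, (⟨((a k j : S) : L), hle (a k j).2⟩ : S') * w' j := by
      simp only [hc, sub_mul, Finset.sum_sub_distrib, hδw]
    have hsum : ∑ i, cvec i * z i = -r * x' + ∑ j, δ j * w' j := by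
      rw [Fin.sum_univ_succ]
      simp only [hcvec, hz, Fin.cons_zero, Fin.cons_succ]
    have hmem' : ∑ i, cvec i * z i ∈ maximalIdeal S' ^ 2 := by
      rw [hsum, hδsum, ← hmy, ← hr]
      have e4 : -r * x' + (m + r * x') = m := by ring
      rw [e4]
      exact hm
    have hj := mem_maximalIdeal_of_sum_mul_rsop_mem_sq hsfr z hzspan cvec hmem' j.succ
    simp only [hcvec, Fin.cons_succ, hδ] at hj
    -- units descend from `S'` to `S`
    by_contra hc
    have hu : IsUnit ((if k = j then (1 : S) else 0) - a k j) := IsLocalRing.notMem_maximalIdeal.mp hc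
    exact (IsLocalRing.mem_maximalIdeal _).mp hj (hu.map (Subring.inclusion hle))
  -- `ℓ_k ≡ w_k (mod 𝔪_S²)`
  set ℓ : Fin 3 → S := fun k => ∑ j, a k j * w j with hℓ
  have hℓ_le : Ideal.span (Set.range ℓ) ≤ Ideal.span (Set.range w) ⊔ maximalIdeal S ^ 2 := by
    refine Ideal.span_le.mpr ?_
    rintro _ ⟨k, rfl⟩
    have hδw : ∑ j, (if k = j then (1 : S) else 0) * w j = w k := by simp [Finset.sum_ite_eq]
    have e1 : ℓ k = w k - ∑ j, ((if k = j then (1 : S) else 0) - a k j) * w j := by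
      simp only [hℓ, sub_mul, Finset.sum_sub_distrib, hδw]
      ring
    rw [e1]
    refine sub_mem (Ideal.mem_sup_left (Ideal.subset_span ⟨k, rfl⟩)) (Ideal.mem_sup_right ?_)
    refine Ideal.sum_mem _ fun j _ => ?_
    rw [pow_two]
    exact Ideal.mul_mem_mul (hcoef k j) (hwm j)
  have hwle : Ideal.span (Set.range w) ≤ maximalIdeal S := Ideal.span_le.mpr (by rintro _ ⟨j, rfl⟩; exact hwm j)
  have hpow := pow_le_pow_sup_pow_succ hℓ_le hwle d
  -- `(w)^d ⊆ (w₀) + (w₁, w₂)^d`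
  have hrange : Set.range w = insert (w 0) (Set.range fun j : Fin 2 => w j.succ) := by
    have : w = Fin.cons (w 0) (fun j : Fin 2 => w j.succ) := by
      funext i; refine Fin.cases ?_ (fun j => ?_) i <;> simp
    conv_lhs => rw [this]
    rw [Fin.range_cons]
  have hwpow : Ideal.span (Set.range w) ^ d ≤ Ideal.span {w 0} ⊔ Ideal.span (Set.range fun j : Fin 2 => w j.succ) ^ d := by
    rw [hrange, Ideal.span_insert]
    exact sup_pow_le_sup_pow _ _ d
  obtain ⟨p, hp, m, hm, hpm⟩ := Submodule.mem_sup.mp hmem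
  rw [← hpm]
  refine add_mem ?_ (Ideal.mem_sup_right hm)
  obtain ⟨p₁, hp₁, p₂, hp₂, rfl⟩ := Submodule.mem_sup.mp (hpow hp)
  refine add_mem (Ideal.mem_sup_left (hwpow hp₁)) (Ideal.mem_sup_right hp₂)

/-- **The cone at `A′` from the visit law.** As `mem_sup_of_mul_sub_sq_mem_pow`, with its hypothesis produced from the squared visit law of the
step `(A′, N′)` — `f₃·x₂^(d−1)·W'² = F + E²` in `L` (`E` the unit multiple of `γ₂ + G₂`) — and a cleaner of order `d + 1` at `N′`
(`f₃ − γ₃² ∈ 𝔪_{S'}^(d+1)`): then `x₂^(d−1) ∣ E²`, `W'²f₃ = x₂F' + Δ²` and `x₂F' − (W'γ₃ + Δ)² ∈ 𝔪'^(d+1)`. [folklore] -/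
theorem mem_sup_of_law_of_clean (h2 : (2 : L) = 0) (S S' : Subring L) [IsLocalRing S] [IsLocalRing S']
    (hle : S ≤ S') (hreg' : IsRegularLocalRing S') (hdim' : ringKrullDim S' = (4 : ℕ))
    (x₂ : S) (hx₂0 : (x₂ : L) ≠ 0) (w : Fin 3 → S) (hx₂w : Ideal.span (insert x₂ (Set.range w)) = maximalIdeal S)
    (w' : Fin 3 → S') (hw : ∀ j, ((w j : S) : L) = (x₂ : L) * ((w' j : S') : L))
    (hm' : Ideal.span (insert (⟨(x₂ : L), hle x₂.2⟩ : S') (Set.range w')) = maximalIdeal S')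
    (hrat : ∀ a : S', ∃ b : S, a - ⟨(b : L), hle b.2⟩ ∈ maximalIdeal S')
    {d e : ℕ} (hde : d + 1 = 2 * e) (F : S) (hFd : F ∈ maximalIdeal S ^ d) (F' : S')
    (hlawF : ((F' : S') : L) * (x₂ : L) ^ d = ((F : S) : L))
    (f₃ W' E : S') (hlaw : ((f₃ : S') : L) * (x₂ : L) ^ (d - 1) * ((W' : S') : L) ^ 2 = ((F : S) : L) + ((E : S') : L) ^ 2)
    (hclean : ∃ γ₃ : S', f₃ - γ₃ ^ 2 ∈ maximalIdeal S' ^ (d + 1)) :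
    F ∈ Ideal.span {w 0} ⊔ Ideal.span (Set.range fun j : Fin 2 => w j.succ) ^ d ⊔ maximalIdeal S ^ (d + 1) := by
  classical
  haveI := hreg'
  haveI := isDomain_of_isRegularLocalRing S'
  have he : 1 ≤ e := by omega
  have hd1 : d - 1 = 2 * (e - 1) := by omega
  have h2S' : (2 : S') = 0 := Subtype.ext (by change S'.subtype 2 = S'.subtype 0; rw [map_ofNat, map_zero]; exact h2)
  set x' : S' := ⟨(x₂ : L), hle x₂.2⟩ with hx'
  have hsfr : (maximalIdeal S').spanFinrank = 4 := by
    have h := IsRegularLocalRing.spanFinrank_maximalIdeal (R := S')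
    rw [hdim'] at h
    exact_mod_cast h
  set z : Fin 4 → S' := Fin.cons x' w' with hz
  have hzspan : Ideal.span (Set.range z) = maximalIdeal S' := by rw [hz, Fin.range_cons, hm']
  have hx'm : x' ∈ maximalIdeal S' := by rw [← hm']; exact Ideal.subset_span (Set.mem_insert _ _)
  have hx'2 : x' ∉ maximalIdeal S' ^ 2 := by
    have := not_mem_sq_of_span_eq hsfr z hzspan 0
    simpa [hz] using this
  have hx'0 : x' ≠ 0 := fun h => hx₂0 (congrArg Subtype.val h)
  have hxprime : Prime x' := (Ideal.span_singleton_prime hx'0).mp (SigmaTopLegality.isPrime_span_singleton_of_not_mem_sq S' hx'm hx'2)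
  -- `E² = x₂^(d−1) · (W'² f₃ − x₂ F')`
  have hx'L : ((x' : S') : L) = (x₂ : L) := rfl
  have hsq' : E ^ 2 = x' ^ (d - 1) * (W' ^ 2 * f₃ - x' * F') := by
    apply Subtype.ext
    push_cast
    rw [hx'L]
    have hd' : (x₂ : L) ^ d = (x₂ : L) * (x₂ : L) ^ (d - 1) := by
      rw [← pow_succ', Nat.sub_add_cancel (by omega : 1 ≤ d)]
    have e1 : (x₂ : L) * (((F' : S') : L) * (x₂ : L) ^ (d - 1)) = ((F : S) : L) := by
      rw [← hlawF, hd']; ring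
    linear_combination (-1 : L) * hlaw + e1
  have hsq : E ^ 2 = x' ^ (2 * (e - 1)) * (W' ^ 2 * f₃ - x' * F') := by rw [← hd1]; exact hsq'
  obtain ⟨Δ, hΔ⟩ := pow_dvd_of_pow_two_mul_dvd_sq hxprime (e - 1) (a := E) ⟨_, hsq⟩
  have hstruct : W' ^ 2 * f₃ = x' * F' + Δ ^ 2 := by
    have hne : x' ^ (2 * (e - 1)) ≠ 0 := pow_ne_zero _ hx'0
    have h3 : x' ^ (2 * (e - 1)) * (W' ^ 2 * f₃ - x' * F') = x' ^ (2 * (e - 1)) * Δ ^ 2 := by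
      rw [← hsq, hΔ]; ring
    have h4 := mul_left_cancel₀ hne h3
    linear_combination h4
  obtain ⟨γ₃, hγ₃⟩ := hclean
  have hyp : ∃ g' : S', x' * F' - g' ^ 2 ∈ maximalIdeal S' ^ (d + 1) := by
    refine ⟨W' * γ₃ + Δ, ?_⟩
    have : x' * F' - (W' * γ₃ + Δ) ^ 2 = W' ^ 2 * (f₃ - γ₃ ^ 2) := by
      linear_combination (-1 : S') * hstruct + (-(W' * γ₃ * Δ) - Δ ^ 2) * h2S'
    rw [this]
    exact Ideal.mul_mem_left _ _ hγ₃
  exact mem_sup_of_mul_sub_sq_mem_pow h2 S S' hle hreg' hdim' x₂ hx₂0 w hx₂w w' hw hm' hrat hde F hFd F' hlawF hyp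

end Summit.ResolutionOfSingularities.ResolutionOfSingularities.Theorems.SwitchingDichotomy.BinaryResidue

end
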